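import Mathlib.Algebra.Group.Subgroup.Basic
import Mathlib.GroupTheory.Perm.Basic
import Literature.NumberTheory.Transcendental.EclIsoAutomorphisms
import Literature.NumberTheory.Transcendental.EclExchangeProofs
import Literature.NumberTheory.Transcendental.EclClosureOperatorProofs
import Literature.ModelTheory.Quasiminimal.PregeometryStructures
import HarnessLib

/-!
# Automorphisms over the closure of the base in countable strongly exponentially-algebraically
closed fields: Galois types, generic types, and the pregeometry

M. Bays, J. Kirby, *Pseudo-exponential maps, variants, and quasiminimality*, Algebra & Number
Theory 12 (2018), §6: the countable model `M = M(F_base)` is a quasiminimal pregeometry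
structure for the pregeometry `Γcl` (= `ecl` localised at the base, Remark 10.10) and a language
in which quantifier-free types of finite tuples are automorphism orbits (Prop. 6.5, Remark 6.6,
Thm 6.9). This file sets up, for a countable algebraically closed exponential field `M` with
surjective `exp` which is strongly exponentially-algebraically closed and infinite dimensional,
and a base set `S ⊆ M`:

* `SEACModel.baseAut S` — the group `Aut(M / ecl S)` of automorphisms of the exponential field
  fixing the closure of the base pointwise, as a subgroup of `Equiv.Perm M`;
* `SEACModel.image_ecl_union` — these automorphisms respect the localised closure
  `C ↦ ecl (S ∪ C)` (QM1 of Def. 6.1 for Galois types);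
* `SEACModel.exists_mem_baseAut_of_isEIsoOn` — isomorphisms of closures of finite tuples over
  `ecl S` are restrictions of elements of `Aut(M / ecl S)` (Thm 6.9, proof of QM5a, via
  `ZilberHomogeneity.exists_exponentialRingEquiv_of_isEIsoOn`);
* `SEACModel.exists_mem_baseAut_apply_eq_of_notMem` — uniqueness of the generic type over finite
  sets: two elements outside `ecl (S ∪ ȳ)` are conjugate over `ȳ` (Thm 6.9, proof of QM4);
* `SEACModel.isPregeometry_ecl_union` — `C ↦ ecl (S ∪ C)` is a pregeometry (Kirby 2010, Thm 1.1,
  localised at `S`).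

All statements are about the group and the closure operator only; the language enters in
`SEACSetup.lean`.

## References

* M. Bays, J. Kirby, *Pseudo-exponential maps, variants, and quasiminimality*, Algebra & Number
  Theory 12 (2018) 493–549: Def. 6.1, Prop. 6.5, Remark 6.6, Thm 6.9, Remark 10.10.
* J. Kirby, *Exponential algebraicity in exponential fields*, Bull. LMS 42 (2010): Thm 1.1.
* J. Kirby, *On quasiminimal excellent classes*, J. Symbolic Logic 75 (2010): Thm 2.1.
-/

noncomputable section

open Set

universe u

namespace Literature.NumberTheory.Transcendental

namespace SEACModel

open Literature.ModelTheory.ExponentialFields.ExponentialRing Literature.ModelTheory.Quasiminimal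
  ZilberHomogeneity

variable {M : Type u} [Field M] [Literature.ModelTheory.ExponentialFields.ExponentialRing M]

/-! ### Automorphisms of the exponential field as permutations -/

/-- An automorphism of the exponential field as a permutation. [folklore] -/
def toPerm (ρ : ExponentialRingEquiv M M) : Equiv.Perm M where
  toFun := ρ
  invFun := ρ.symm
  left_inv := ρ.symm_apply_apply
  right_inv := ρ.apply_symm_apply

/-- `toPerm ρ` is `ρ` as a function. [folklore] -/
@[simp] theorem coe_toPerm (ρ : ExponentialRingEquiv M M) : ⇑(toPerm ρ) = ρ := rfl

/-- **`Aut(M / ecl S)`**: the automorphisms of the exponential field `M` fixing the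
exponential-algebraic closure of `S` pointwise, as a subgroup of the permutations of `M`
(Bays–Kirby 2018, Thm 6.9: `Γ`-field automorphisms over the base; the base Γ-field is contained in
`ecl S` for `S` a set of generators). [cite: BaysKirby2018ANT, Thm 6.9 (proof) and Remark 6.6] -/
def baseAut (S : Set M) : Subgroup (Equiv.Perm M) where
  carrier := {σ | (∃ ρ : ExponentialRingEquiv M M, (⇑ρ : M → M) = ⇑σ) ∧ ∀ x ∈ ecl S, σ x = x}
  mul_mem' := by
    rintro σ τ ⟨⟨ρ₁, hρ₁⟩, hσ⟩ ⟨⟨ρ₂, hρ₂⟩, hτ⟩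
    refine ⟨⟨ρ₂.trans ρ₁, ?_⟩, fun x hx => ?_⟩
    · funext x
      simp only [ExponentialRingEquiv.trans_apply, Equiv.Perm.coe_mul, Function.comp_apply]
      rw [← hρ₁, ← hρ₂]
    · rw [Equiv.Perm.mul_apply, hτ x hx, hσ x hx]
  one_mem' := ⟨⟨ExponentialRingEquiv.refl M, rfl⟩, fun _ _ => rfl⟩
  inv_mem' := by
    rintro σ ⟨⟨ρ, hρ⟩, hσ⟩
    refine ⟨⟨ρ.symm, ?_⟩, fun x hx => ?_⟩
    · funext y
      symm
      rw [Equiv.Perm.inv_eq_iff_eq, ← hρ]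
      exact (ρ.apply_symm_apply y).symm
    · rw [Equiv.Perm.inv_eq_iff_eq]
      exact (hσ x hx).symm

/-- Membership in `Aut(M / ecl S)`. [folklore] -/
theorem mem_baseAut_iff {S : Set M} {σ : Equiv.Perm M} :
    σ ∈ baseAut S ↔ (∃ ρ : ExponentialRingEquiv M M, (⇑ρ : M → M) = ⇑σ) ∧ ∀ x ∈ ecl S, σ x = x :=
  Iff.rfl

/-- An automorphism fixing `ecl S` pointwise, as an element of `Aut(M / ecl S)`. [folklore] -/
theorem toPerm_mem_baseAut {S : Set M} (ρ : ExponentialRingEquiv M M) (hρ : ∀ x ∈ ecl S, ρ x = x) :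
    toPerm ρ ∈ baseAut S :=
  ⟨⟨ρ, rfl⟩, hρ⟩

/-- Elements of `Aut(M / ecl S)` are automorphisms of the exponential field. [folklore] -/
theorem exists_equiv_of_mem_baseAut {S : Set M} {σ : Equiv.Perm M} (hσ : σ ∈ baseAut S) :
    ∃ ρ : ExponentialRingEquiv M M, (⇑ρ : M → M) = ⇑σ :=
  hσ.1

/-- Elements of `Aut(M / ecl S)` fix `ecl S` pointwise. [folklore] -/
theorem apply_eq_of_mem_baseAut {S : Set M} {σ : Equiv.Perm M} (hσ : σ ∈ baseAut S) {x : M}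
    (hx : x ∈ ecl S) : σ x = x :=
  hσ.2 x hx

/-- Elements of `Aut(M / ecl S)` fix `S` pointwise. [folklore] -/
theorem apply_eq_of_mem_baseAut_of_mem {S : Set M} {σ : Equiv.Perm M} (hσ : σ ∈ baseAut S) {x : M}
    (hx : x ∈ S) : σ x = x :=
  hσ.2 x (subset_ecl S hx)

/-- Shrinking the base enlarges the group. [folklore] -/
theorem baseAut_mono {S T : Set M} (h : S ⊆ T) : baseAut T ≤ baseAut S :=
  fun _ hσ => ⟨hσ.1, fun x hx => hσ.2 x (ecl_mono h hx)⟩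

/-! ### QM1: automorphisms respect the closure -/

/-- Automorphisms of the exponential field map closures to closures: `σ(ecl C) = ecl(σ C)`.
[cite: Kirby2010QMEC, Lemma 1.3] -/
theorem image_ecl_of_mem_baseAut {S : Set M} {σ : Equiv.Perm M} (hσ : σ ∈ baseAut S) (C : Set M) :
    ⇑σ '' ecl C = ecl (⇑σ '' C) := by
  obtain ⟨ρ, hρ⟩ := hσ.1
  rw [← hρ]
  exact Khovanskii.image_ecl_equiv ρ C

/-- **QM1 for Galois types**: an automorphism over `ecl S` carries the localised closure
`ecl (S ∪ C)` onto `ecl (S ∪ σ C)`. [cite: BaysKirby2018ANT, Thm 6.9 (QM1)] -/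
theorem image_ecl_union {S : Set M} {σ : Equiv.Perm M} (hσ : σ ∈ baseAut S) (C : Set M) :
    ⇑σ '' ecl (S ∪ C) = ecl (S ∪ ⇑σ '' C) := by
  rw [image_ecl_of_mem_baseAut hσ, image_union]
  congr 2
  refine Subset.antisymm ?_ fun x hx => ⟨x, hx, apply_eq_of_mem_baseAut_of_mem hσ hx⟩
  rintro _ ⟨x, hx, rfl⟩
  rwa [apply_eq_of_mem_baseAut_of_mem hσ hx]

/-- Membership form of `image_ecl_union`: `a ∈ ecl (S ∪ C) ↔ σ a ∈ ecl (S ∪ σ C)`.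
[cite: BaysKirby2018ANT, Thm 6.9 (QM1)] -/
theorem apply_mem_ecl_union_iff {S : Set M} {σ : Equiv.Perm M} (hσ : σ ∈ baseAut S) (C : Set M)
    (a : M) : σ a ∈ ecl (S ∪ ⇑σ '' C) ↔ a ∈ ecl (S ∪ C) := by
  rw [← image_ecl_union hσ C]
  exact σ.injective.mem_set_image

/-- Tuple form: if `σ ∘ x = y` then `a ∈ ecl (S ∪ range x) ↔ σ a ∈ ecl (S ∪ range y)`.
[cite: BaysKirby2018ANT, Thm 6.9 (QM1)] -/
theorem apply_mem_ecl_union_range_iff {S : Set M} {σ : Equiv.Perm M} (hσ : σ ∈ baseAut S) {n : ℕ}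
    {x y : Fin n → M} (hxy : ⇑σ ∘ x = y) (a : M) :
    σ a ∈ ecl (S ∪ range y) ↔ a ∈ ecl (S ∪ range x) := by
  rw [← hxy, range_comp]
  exact apply_mem_ecl_union_iff hσ _ a

/-! ### Isomorphisms of closures are restrictions of automorphisms -/

section Countable

variable [CharZero M] [IsAlgClosed M] [Countable M]

/-- **Isomorphisms of closures of finite tuples over `ecl S` extend to elements of
`Aut(M / ecl S)`** (Bays–Kirby 2018, Thm 6.9, proof of QM5a: "`θ₀` extends to an automorphism `θ`
of `M`"; Kirby 2010 Thm 2.1 / Cor. 2.2), for `S` finite.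
[cite: BaysKirby2018ANT, Thm 6.9 (proof)] [cite: Kirby2010QMEC, Thm 2.1] -/
theorem exists_mem_baseAut_of_isEIsoOn (hsurj : IsSurjectiveOntoUnits M)
    (hSEAC : IsStronglyExpAlgClosed M) (hinf : ∀ C : Set M, C.Finite → ∃ d, d ∉ ecl C)
    {S : Set M} (hS : S.Finite) {n : ℕ} {x y : Fin n → M} {g : M → M}
    (hg : IsEIsoOn g (ecl (S ∪ range x)) (ecl (S ∪ range y))) (hfix : ∀ z ∈ ecl S, g z = z)
    (hgx : ∀ i, g (x i) = y i) :
    ∃ σ ∈ baseAut S, ⇑σ ∘ x = y := by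
  classical
  -- enumerate `S`
  obtain ⟨k, s, hs⟩ : ∃ (k : ℕ) (s : Fin k → M), range s = S := by
    haveI := hS.fintype
    obtain ⟨k, ⟨e⟩⟩ := Finite.exists_equiv_fin S
    refine ⟨k, fun i => (e.symm i : M), ?_⟩
    ext z
    constructor
    · rintro ⟨i, rfl⟩; exact (e.symm i).2
    · intro hz; exact ⟨e ⟨z, hz⟩, by simp⟩
  have h1 : range (Fin.append s x) = S ∪ range x := by rw [ZilberHomogeneity.range_append, hs]
  have h2 : range (Fin.append s y) = S ∪ range y := by rw [ZilberHomogeneity.range_append, hs]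
  have hg' : IsEIsoOn g (ecl (range (Fin.append s x))) (ecl (range (Fin.append s y))) := by
    rw [h1, h2]; exact hg
  obtain ⟨ρ, hρ⟩ := exists_exponentialRingEquiv_of_isEIsoOn hsurj hSEAC hinf hg'
  rw [h1] at hρ
  refine ⟨toPerm ρ, toPerm_mem_baseAut ρ fun z hz => ?_, ?_⟩
  · rw [hρ (ecl_mono subset_union_left hz)]; exact hfix z hz
  · funext i
    rw [Function.comp_apply, coe_toPerm, hρ (subset_ecl _ (Or.inr ⟨i, rfl⟩))]
    exact hgx i

/-- **Uniqueness of the generic type over finite sets** (Bays–Kirby 2018, Thm 6.9, proof of QM4;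
Bays–Kirby 2013 Prop. 5 (i)): if `a, a' ∉ ecl (S ∪ ȳ)` then some automorphism over `ecl S`
fixes `ȳ` and maps `a ↦ a'`. Proof: extend the identity of `ecl (S ∪ ȳ)` by `a ↦ a'`
(`ZilberHomogeneity.eclIso_extension_of_isStronglyExpAlgClosed`) and then to an automorphism.
[cite: BaysKirby2018ANT, Thm 6.9 (QM4)] [cite: BaysKirby2013Excellence, Prop. 5] -/
theorem exists_mem_baseAut_apply_eq_of_notMem (hsurj : IsSurjectiveOntoUnits M)
    (hSEAC : IsStronglyExpAlgClosed M) (hinf : ∀ C : Set M, C.Finite → ∃ d, d ∉ ecl C)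
    {S : Set M} (hS : S.Finite) {n : ℕ} (y : Fin n → M) {a a' : M}
    (ha : a ∉ ecl (S ∪ range y)) (ha' : a' ∉ ecl (S ∪ range y)) :
    ∃ σ ∈ baseAut S, (∀ i, σ (y i) = y i) ∧ σ a = a' := by
  classical
  have hccp : HasCountableClosureProperty M := HasCountableClosureProperty.of_countable
  obtain ⟨k, s, hs⟩ : ∃ (k : ℕ) (s : Fin k → M), range s = S := by
    haveI := hS.fintype
    obtain ⟨k, ⟨e⟩⟩ := Finite.exists_equiv_fin S
    refine ⟨k, fun i => (e.symm i : M), ?_⟩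
    ext z
    constructor
    · rintro ⟨i, rfl⟩; exact (e.symm i).2
    · intro hz; exact ⟨e ⟨z, hz⟩, by simp⟩
  have h1 : range (Fin.append s y) = S ∪ range y := by rw [ZilberHomogeneity.range_append, hs]
  obtain ⟨g, hg, hEq, hga⟩ := eclIso_extension_of_isStronglyExpAlgClosed hsurj hSEAC hccp
    (Fin.append s y) (Fin.append s y) id (IsEIsoOn.id _) (a := a) (a' := a')
    (by rw [h1]; exact ha) (by rw [h1]; exact ha')
  -- as an isomorphism `ecl (S ∪ range (y, a)) ≅ ecl (S ∪ range (y, a'))`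
  have e1 : ∀ c : M, ecl (S ∪ range (Fin.snoc y c : Fin (n + 1) → M)) =
      ecl (insert c (range (Fin.append s y))) := fun c => by
    rw [Fin.range_snoc, h1, union_insert]
  have hg2 : IsEIsoOn g (ecl (S ∪ range (Fin.snoc y a : Fin (n + 1) → M)))
      (ecl (S ∪ range (Fin.snoc y a' : Fin (n + 1) → M))) := by
    rw [e1, e1]; exact hg
  have hfix : ∀ z ∈ ecl S, g z = z := fun z hz =>
    hEq (ecl_mono (by rw [h1]; exact subset_union_left) hz)
  obtain ⟨σ, hσ, hσx⟩ := exists_mem_baseAut_of_isEIsoOn hsurj hSEAC hinf hS hg2 hfix (fun i => by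
    refine Fin.lastCases ?_ (fun j => ?_) i
    · simpa using hga
    · simp only [Fin.snoc_castSucc]
      exact hEq (subset_ecl _ (by rw [h1]; exact Or.inr ⟨j, rfl⟩)))
  refine ⟨σ, hσ, fun i => ?_, ?_⟩
  · have := congrFun hσx (Fin.castSucc i)
    simpa using this
  · have := congrFun hσx (Fin.last n)
    simpa using this

end Countable

/-! ### The localised closure is a pregeometry -/

section Pregeometry


/-- **`C ↦ ecl (S ∪ C)` is a pregeometry** (Kirby 2010, Thm 1.1: `ecl` is a pregeometry — closure
operator of finite character with exchange; localising a pregeometry at a set gives a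
pregeometry). This is `Γcl` over the base when `S` generates the base (Bays–Kirby 2018,
Remark 10.10). [cite: Kirby2010, Thm. 1.1] [cite: BaysKirby2018ANT, Lemma 4.12 and Remark 10.10] -/
theorem isPregeometry_ecl_union (S : Set M) : IsPregeometry (fun C : Set M => ecl (S ∪ C)) where
  subset_cl A := (subset_union_right).trans (subset_ecl _)
  mono A B h := ecl_mono (union_subset_union_right S h)
  cl_cl A := by
    refine Subset.antisymm ?_ (ecl_mono (union_subset_union_right S
      ((subset_union_right).trans (subset_ecl (S ∪ A)))))
    have : S ∪ ecl (S ∪ A) ⊆ ecl (S ∪ A) :=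
      union_subset ((subset_union_left).trans (subset_ecl _)) Subset.rfl
    calc ecl (S ∪ ecl (S ∪ A)) ⊆ ecl (ecl (S ∪ A)) := ecl_mono this
      _ = ecl (S ∪ A) := Khovanskii.ecl_ecl _
  finite_character := by
    intro A a ha
    obtain ⟨C₀, hC₀, haC₀⟩ :=
      (Kirby2010_ecl_finiteCharacter_holds M).exists_finset (C := S ∪ A) ha
    refine ⟨(↑C₀ : Set M) ∩ A, fun x hx => hx.2, C₀.finite_toSet.inter_of_left A, ?_⟩
    refine ecl_mono (fun x hx => ?_) haC₀
    rcases hC₀ hx with hxS | hxA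
    · exact Or.inl hxS
    · exact Or.inr ⟨hx, hxA⟩
  exchange := by
    intro A a b hab ha
    have h := Kirby2010_ecl_exchange_holds (K := M) (S ∪ A) a b (by rwa [← union_insert]) ha
    rwa [← union_insert] at h

/-- Elements of `S` lie in every localised closure. [folklore] -/
theorem subset_ecl_union (S C : Set M) : S ⊆ ecl (S ∪ C) :=
  (subset_union_left).trans (subset_ecl _)

/-- `ecl S ⊆ ecl (S ∪ C)`. [folklore] -/
theorem ecl_subset_ecl_union (S C : Set M) : ecl S ⊆ ecl (S ∪ C) :=
  ecl_mono subset_union_left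

/-- `ecl C ⊆ ecl (S ∪ C)` — the localised closure dominates `ecl`. [folklore] -/
theorem ecl_subset_ecl_union' (S C : Set M) : ecl C ⊆ ecl (S ∪ C) :=
  ecl_mono subset_union_right

/-- A closed set of the localised pregeometry contains `ecl S`. [folklore] -/
theorem ecl_subset_of_closed {S H : Set M} (hH : ecl (S ∪ H) = H) : ecl S ⊆ H :=
  (ecl_subset_ecl_union S H).trans hH.subset

/-- A closed set of the localised pregeometry absorbs the closures of its finite subsets.
[folklore] -/
theorem ecl_union_subset_of_closed {S H C : Set M} (hH : ecl (S ∪ H) = H) (hC : C ⊆ H) :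
    ecl (S ∪ C) ⊆ H :=
  (ecl_mono (union_subset_union_right S hC)).trans hH.subset

end Pregeometry

end SEACModel

end Literature.NumberTheory.Transcendental
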